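import Summits.CriticalPhenomena.PercolationContinuityZ3.Theorems.Transplant.D10SKc00_0055P1
import HarnessLib

/-!
# Diamond film `D_10` — KERNEL CERTIFICATE for the class `00_0055` of `ShapedLinkageX 4 (DiamondFilm.sqShadow (k := 10))`, THE CLASS (mask + coverage from the 1 parts) (template `fullmcp`, |W| = 106, 1482 terminal pairs, 4627 plans)

builds on p205010 (kernel theorem, internal audit signed; external expert review pending) — NOT used in this file.  Lane `prim-bschramm`, seat `prim-bschramm-p2` (gen 43; class C1b;
memo `HOME/bschramm/P2-LATTICES.md` §152); helper file (`--supports stmt-CriticalPhenomena-4575 --as helper`).  Generated by `cert/emit_dk.py` from the plans of `cert/gen_dk.py`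
(canonical BFS routings with avoid hints, exact mirror `cert/kern_dk.py` of «DkSKDefs»); re-checked here by the kernel (`DCtx.checkEs`); `caseOK_k10_00_0055` feeds «D10SKFinal».
[cite: DuminilCopinSidoraviciusTassion2016, §2.3 (proof of Fact 2: the three disjoint paths in B_R(z))]
-/

namespace Summit.CriticalPhenomena.PercolationContinuityZ3.Theorems.Transplant

namespace DiamondFilm.DK

/-- The cleared mask of the class `00_0055` of `D_10` is admissible (inside the cleared block, containing the forced core). [folklore] -/
theorem wOK_k10_00_0055 : DCtx.wOK (⟨10, 0, 0, 0, 0, 5, 5, 96470028883407749667584185736059687430347848871571147802354240666771263631141954925623855058629415742554112⟩ : DCtx) = true := by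
  decide +kernel

/-- **THE CLASS `00_0055` OF `D_10` IS COVERED**: every needed bit of every certified terminal pair has a swap-pair plan. [cite: DuminilCopinSidoraviciusTassion2016, §2.3 (proof of Fact 2)] -/
theorem caseOK_k10_00_0055 : CaseOK (⟨10, 0, 0, 0, 0, 5, 5, 96470028883407749667584185736059687430347848871571147802354240666771263631141954925623855058629415742554112⟩ : DCtx) :=
  caseOK_of_chunks _ [[14, 16, 18, 20, 25, 27], [29, 31, 33, 49, 51, 55], [57, 62, 68, 158, 159, 160], [161, 162, 163, 164, 169, 177], [181, 189, 193, 201, 206, 212], [303, 305, 307, 313, 321, 325], [333, 337, 345]]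
    (List.forall_mem_cons.2 ⟨checkEs_sound _ _ _ chunk_k10_00_0055_0, List.forall_mem_cons.2 ⟨checkEs_sound _ _ _ chunk_k10_00_0055_1, List.forall_mem_cons.2 ⟨checkEs_sound _ _ _ chunk_k10_00_0055_2, List.forall_mem_cons.2 ⟨checkEs_sound _ _ _ chunk_k10_00_0055_3, List.forall_mem_cons.2 ⟨checkEs_sound _ _ _ chunk_k10_00_0055_4, List.forall_mem_cons.2 ⟨checkEs_sound _ _ _ chunk_k10_00_0055_5, List.forall_mem_cons.2 ⟨checkEs_sound _ _ _ chunk_k10_00_0055_6, List.forall_mem_nil _⟩⟩⟩⟩⟩⟩⟩)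
    (by decide +kernel)

end DiamondFilm.DK

end Summit.CriticalPhenomena.PercolationContinuityZ3.Theorems.Transplant
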